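import Summits.CriticalPhenomena.PercolationContinuityZ3.Theorems.PercNearOneGluingNoHeavyLowerTailSahiThreeCopyPairStepDictator

/-!
# `NoHeavyLowerTail` (crux stmt-CriticalPhenomena-4575), Sahi programme: **THE PAIR STEP — HENCE THE SLICE LAW (SC) — WITH ONE
# CUMULATION SLOT**: `(SC)` holds whenever one of the three functions is an initial principal cylinder `x₁x₂⋯x_k` (any `k`, the
# sliced coordinate free) and the other two are ARBITRARY nonnegative monotone functions; proof by copy-polarization of the
# functional `K_b` of `…PairStepDictator` and a POINTWISE (case-split, non-multilinear) pair lemma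

Support file (Sahi cell, seat `prim-sahi-p1`, generation 58; `--supports stmt-CriticalPhenomena-4575`); companion of `…SahiThreeCopyOneLevel`
(`scx`, `PairStepLaw`, `sliceLaw_iff_oneLevel`) and `…PairStepDictator` (`psK`, the `k = 1` case).  Pure proofs, one `def` (`psKpol`) and one
recursive `def` (`initPrin d k = x₀x₁⋯x_{k−1}`); no `sorry`, standard axioms.

THE ARGUMENT.  The free face of the one-cube (SC)-excess is `E_b(a,v,w|a,g,h) = H_b(a;vw) + K_b(a; v,g; w,h)`
(`scx_full_left_eq_harris_add_psK`).  Polarize `K_b` in the three COPIES: `P_b(a; t_X, t_Y, t_Z)` (`psKpol`), where the `a`-carrying copy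
sees the quadruple `t_X = (v_X,g_X,w_X,h_X)` and the other two copies see `t_Y`, `t_Z`; `P_b(a;t,t,t) = K_b(a;t)` (`psKpol_diag`).  Along a
coordinate where `a = x₀ ∧ a'` (`glue 0 a'`) the slices of `P` are sums of `P`'s of `a'` in which the `a`-copy sees TOP sections and the other
copies see top or bottom sections (`psKpol_cons_*`), so the SYMMETRIZED functional `S(a; t_X; t_Y, t_Z) := P(a;t_X,t_Y,t_Z) + P(a;t_X,t_Z,t_Y)`
on the class of data with `t_Y, t_Z ≤ t_X` (each quadruple nested: `v ≤ g`, `w ≤ h`) is CLOSED under slicing along the support of `a`.  At `a = 1`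
(`psKpol_one_pair`): `S(1; T; L, M) = 2H_b(v_T, w_T) + N_b(v_T−v_M; w_T−w_L; 1) + N_b(v_T−v_L; w_T−w_M; 1) + N_b(p_L; q_T−q_M; 1) + N_b(p_M; q_T−q_L; 1)
+ N_b(p_T; q_L+q_M; 1)` (`p = g − v`, `q = h − w`), and the last five terms are nonnegative ARRANGEMENT BY ARRANGEMENT by the four-case lemma
`pairPointwise` (`(v_T−v_M)(w_T−w_L) + (v_T−v_L)(w_T−w_M) + p_L(q_T−q_M) + p_M(q_T−q_L) + p_T(q_L+q_M) ≥ 0` whenever `t_L, t_M ≤ t_T` nested) —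
NOT arrangement-free: the `N`-terms with `q_T − q_M` have no sign.  Induction on the dimension for `a = initPrin d k` (`1`, `x₀`, `x₀x₁`, …) gives
`psKpol_sym_nonneg`, hence ★ `psK_initPrincipal_nonneg` (`K_b(a;·) ≥ 0`), ★ `pairStep_initPrincipal` (`0 ≤ E_b(a,v,w|a,g,h)`, the pair step
for an initial-principal free slot) and ★★ `sliceLaw_initPrincipal_free`: **`2c_B(F¹,G¹,H¹) ≤ c_{(2,B)}(F,G,H)` for `F = x₁⋯x_k` (a principal
up-set of the old coordinates with initial support) and ARBITRARY nonnegative monotone `G, H`.**  With `sliceLaw_andAdj` (AND-literal slot) and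
multi-affinity in the bottom section this covers every `F = (α + βx₀)·x₁⋯x_k`.  General principal up-sets / coordinate products follow by relabeling
coordinates and nonnegative combination (not typed here).  The SC-analogue of gen53's `tc_cprod_nonneg` (3C with a cumulation slot); the first
`(SC)` class with an arbitrary `x₀`-free cumulation slot, and — like `…PairStepDictator` — a proof that no nonnegative combination of three-copy
Harris/positivity atoms can give (memo FROM-prim-sahi-p1-gen58 §7).  [this work]
-/

namespace Summit.CriticalPhenomena.PercolationContinuityZ3.Theorems.SahiThreeCopy

open Finset Function Literature.Combinatorics.Sahi2008
open scoped BigOperators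

noncomputable section

variable {d : ℕ}

/-! ### §1 The pointwise pair lemma (four cases) -/

/-- ★ **The pair lemma**: for reals with `0 ≤ pT, pL, pM`, `0 ≤ α, β`, `pL ≤ pT + α`, `pM ≤ pT + β` and `0 ≤ qT, qL, qM`, `0 ≤ α', β'`,
`qL ≤ qT + α'`, `qM ≤ qT + β'`:  `0 ≤ β·α' + α·β' + pL·(qT − qM) + pM·(qT − qL) + pT·(qL + qM)`.  Cases on the signs of `qT − qM`, `qT − qL`.
[this work] -/
theorem pairPointwise {α β pT pL pM α' β' qT qL qM : ℝ} (hα : 0 ≤ α) (hβ : 0 ≤ β) (hpT : 0 ≤ pT) (hpL : 0 ≤ pL) (hpM : 0 ≤ pM)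
    (hL : pL ≤ pT + α) (hM : pM ≤ pT + β) (hα' : 0 ≤ α') (hβ' : 0 ≤ β') (hqT : 0 ≤ qT) (hqL : 0 ≤ qL) (hqM : 0 ≤ qM)
    (hL' : qL ≤ qT + α') (hM' : qM ≤ qT + β') :
    0 ≤ β * α' + α * β' + pL * (qT - qM) + pM * (qT - qL) + pT * (qL + qM) := by
  rcases le_total qM qT with h1 | h1 <;> rcases le_total qL qT with h2 | h2
  · nlinarith [mul_nonneg hpL (sub_nonneg.2 h1), mul_nonneg hpM (sub_nonneg.2 h2), mul_nonneg hβ hα', mul_nonneg hα hβ',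
      mul_nonneg hpT hqL, mul_nonneg hpT hqM]
  · -- qL > qT ≥ qM
    have e1 : 0 ≤ pL * (qT - qM) := mul_nonneg hpL (sub_nonneg.2 h1)
    have e2 : pM * (qL - qT) ≤ (pT + β) * (qL - qT) := mul_le_mul_of_nonneg_right hM (sub_nonneg.2 h2)
    have e3 : β * (qL - qT) ≤ β * α' := mul_le_mul_of_nonneg_left (by linarith) hβ
    nlinarith [mul_nonneg hα hβ', mul_nonneg hpT hqT, mul_nonneg hpT hqM]
  · -- qM > qT ≥ qL
    have e1 : 0 ≤ pM * (qT - qL) := mul_nonneg hpM (sub_nonneg.2 h2)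
    have e2 : pL * (qM - qT) ≤ (pT + α) * (qM - qT) := mul_le_mul_of_nonneg_right hL (sub_nonneg.2 h1)
    have e3 : α * (qM - qT) ≤ α * β' := mul_le_mul_of_nonneg_left (by linarith) hα
    nlinarith [mul_nonneg hβ hα', mul_nonneg hpT hqT, mul_nonneg hpT hqL]
  · -- both above qT
    have e2 : pL * (qM - qT) ≤ (pT + α) * (qM - qT) := mul_le_mul_of_nonneg_right hL (sub_nonneg.2 h1)
    have e3 : α * (qM - qT) ≤ α * β' := mul_le_mul_of_nonneg_left (by linarith) hα
    have e4 : pM * (qL - qT) ≤ (pT + β) * (qL - qT) := mul_le_mul_of_nonneg_right hM (sub_nonneg.2 h2)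
    have e5 : β * (qL - qT) ≤ β * α' := mul_le_mul_of_nonneg_left (by linarith) hβ
    nlinarith [mul_nonneg hpT hqT]

/-! ### §2 The copy-polarized functional `P_b(a; t_X, t_Y, t_Z)` -/

/-- **`P_b(a; t_X, t_Y, t_Z)`**: the polarization of `K_b` (`psK`) in the three copies — the `a`-carrying copy sees `t_X = (vX,gX,wX,hX)`, the
second copy sees `t_Y = (vY,gY,wY,hY)` and, in this fixed representative of the symmetric functional, the third copy only sees `(wZ,hZ)`
(symmetrize with `t_Y ↔ t_Z`, cf. `psKpol_sym_nonneg`). [this work] -/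
def psKpol (b : Fin d → ℕ) (a vX gX wX hX vY gY wY hY wZ hZ : Pt d → ℝ) : ℝ :=
  N3 b (a * vX * wX) 1 1 - N3 b (a * vX) wY 1 - N3 b (a * wX) vY 1 + N3 b a vY wZ
  + N3 b (a * (hX - wX)) (gY - vY) 1 + N3 b (a * (gX - vX)) (hY - wY) 1 - N3 b a (gY - vY) (hZ - wZ)

/-- On the diagonal `P_b(a;t,t,t) = K_b(a;t)`. [this work] -/
theorem psKpol_diag (b : Fin d → ℕ) (a v g w h : Pt d → ℝ) :
    psKpol b a v g w h v g w h w h = psK b a v g w h := by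
  unfold psKpol psK
  rw [N3_comm12 b (a * (h - w)) (g - v) 1, N3_comm12 b (a * (g - v)) (h - w) 1]

/-! ### §3 Slices of `P` along a support coordinate `a = x₀ ∧ a'` -/

/-- Sections of differences (plumbing). [this work] -/
private theorem sec_sub_c (f g : Pt (d + 1) → ℝ) (ε : Bool) : sec (f - g) ε = sec f ε - sec g ε := rfl
/-- `N_b(f;0;h) = 0` (plumbing). [this work] -/
private theorem N3_zero_mid_c (b : Fin d → ℕ) (f h : Pt d → ℝ) : N3 b f 0 h = 0 := by rw [N3_comm12, N3_zero_left]

section Slices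
variable (b : Fin d → ℕ) (a' : Pt d → ℝ) (vX gX wX hX vY gY wY hY wZ hZ : Pt (d + 1) → ℝ)

/-- Type-0 slice: the `a`-copy sees the bottom section `0` of `x₀ ∧ a'`, so the slice vanishes. [this work] -/
theorem psKpol_cons_zero : psKpol (Fin.cons 0 b : Fin (d + 1) → ℕ) (glue 0 a') vX gX wX hX vY gY wY hY wZ hZ = 0 := by
  unfold psKpol
  simp only [N3_cons_zero, sec_mul, sec_sub_c, sec_glue_false, zero_mul, N3_zero_left]
  ring

/-- Type-1 slice: `P_{(1,b)}(x₀∧a'; t_X,t_Y,t_Z) = P_b(a'; t_X¹, t_Y⁰, t_Z⁰)`. [this work] -/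
theorem psKpol_cons_one : psKpol (Fin.cons 1 b : Fin (d + 1) → ℕ) (glue 0 a') vX gX wX hX vY gY wY hY wZ hZ =
    psKpol b a' (sec vX true) (sec gX true) (sec wX true) (sec hX true) (sec vY false) (sec gY false) (sec wY false) (sec hY false)
      (sec wZ false) (sec hZ false) := by
  unfold psKpol
  simp only [N3_cons_one, sec_mul, sec_sub_c, sec_one, sec_glue_false, sec_glue_true, zero_mul, N3_zero_left]
  ring

/-- Type-2 slice: `P_{(2,b)}(x₀∧a'; t_X,t_Y,t_Z) = P_b(a'; t_X¹, t_Y¹, t_Z⁰) + P_b(a'; t_X¹, t_Y⁰, t_Z¹)`. [this work] -/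
theorem psKpol_cons_two : psKpol (Fin.cons 2 b : Fin (d + 1) → ℕ) (glue 0 a') vX gX wX hX vY gY wY hY wZ hZ =
    psKpol b a' (sec vX true) (sec gX true) (sec wX true) (sec hX true) (sec vY true) (sec gY true) (sec wY true) (sec hY true)
      (sec wZ false) (sec hZ false)
    + psKpol b a' (sec vX true) (sec gX true) (sec wX true) (sec hX true) (sec vY false) (sec gY false) (sec wY false) (sec hY false)
      (sec wZ true) (sec hZ true) := by
  unfold psKpol
  simp only [N3_cons_two, sec_mul, sec_sub_c, sec_one, sec_glue_false, sec_glue_true, zero_mul, N3_zero_left]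
  ring

/-- Type-3 slice: `P_{(3,b)}(x₀∧a'; ·) = P_b(a'; t_X¹, t_Y¹, t_Z¹)`. [this work] -/
theorem psKpol_cons_three : psKpol (Fin.cons 3 b : Fin (d + 1) → ℕ) (glue 0 a') vX gX wX hX vY gY wY hY wZ hZ =
    psKpol b a' (sec vX true) (sec gX true) (sec wX true) (sec hX true) (sec vY true) (sec gY true) (sec wY true) (sec hY true)
      (sec wZ true) (sec hZ true) := by
  unfold psKpol
  simp only [N3_cons_three, sec_mul, sec_sub_c, sec_one, sec_glue_true]

/-- Empty slices. [this work] -/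
theorem psKpol_cons_add_four (k : ℕ) (a : Pt (d + 1) → ℝ) :
    psKpol (Fin.cons (k + 4) b : Fin (d + 1) → ℕ) a vX gX wX hX vY gY wY hY wZ hZ = 0 := by
  unfold psKpol
  simp only [N3_cons_add_four]
  ring

end Slices

/-! ### §4 The base `a = 1`: the pair identity and its positivity -/

/-- Atom normalisation `N_b(w;v;1) = N_b(v;w;1)` (plumbing). [this work] -/
private theorem cVW (b : Fin d → ℕ) (v w : Pt d → ℝ) : N3 b w v 1 = N3 b v w 1 := N3_comm12 b w v 1
/-- Atom normalisation `N_b(1;v;w) = N_b(v;w;1)` (plumbing). [this work] -/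
private theorem c1VW (b : Fin d → ℕ) (v w : Pt d → ℝ) : N3 b 1 v w = N3 b v w 1 := by rw [N3_comm12, N3_comm23]

/-- ★ **The pair identity at `a = 1`**: `S(1; T; L, M) = 2H_b(v_T,w_T) + N(v_T−v_M; w_T−w_L) + N(v_T−v_L; w_T−w_M) + N(p_L; q_T−q_M)
+ N(p_M; q_T−q_L) + N(p_T; q_L+q_M)` (all `N = N_b(·;·;1)`, `p = g − v`, `q = h − w`; all data real). [this work] -/
theorem psKpol_one_pair (b : Fin d → ℕ) (vX gX wX hX vY gY wY hY vZ gZ wZ hZ : Pt d → ℝ) :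
    psKpol b 1 vX gX wX hX vY gY wY hY wZ hZ + psKpol b 1 vX gX wX hX vZ gZ wZ hZ wY hY =
      2 * (N3 b (vX * wX) 1 1 - N3 b vX wX 1)
      + (N3 b (vX - vZ) (wX - wY) 1 + N3 b (vX - vY) (wX - wZ) 1 + N3 b (gY - vY) ((hX - wX) - (hZ - wZ)) 1
          + N3 b (gZ - vZ) ((hX - wX) - (hY - wY)) 1 + N3 b (gX - vX) ((hY - wY) + (hZ - wZ)) 1) := by
  unfold psKpol
  simp only [one_mul, N3_sub_left, N3_sub_mid, N3_sub_right, N3_add_mid, c1VW, cVW b vY wX, cVW b vZ wX, cVW b gY wX, cVW b gZ wX, cVW b vY hX, cVW b vZ hX, cVW b gY hX, cVW b gZ hX]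
  ring

/-- ★ **`S(1; T; L, M) ≥ 0`** for monotone nonnegative `v_T, w_T` and data with `t_L, t_M ≤ t_T` pointwise, each quadruple nested (`v ≤ g`,
`w ≤ h`): Harris for `2H_b(v_T,w_T)` and `pairPointwise` arrangement by arrangement for the rest. [this work] -/
theorem psKpol_one_pair_nonneg (b : Fin d → ℕ) {vX gX wX hX vY gY wY hY vZ gZ wZ hZ : Pt d → ℝ}
    (hvX : ∀ x, 0 ≤ vX x) (hvXm : Monotone vX) (hwX : ∀ x, 0 ≤ wX x) (hwXm : Monotone wX)
    (nX : ∀ x, vX x ≤ gX x) (nY : ∀ x, vY x ≤ gY x) (nZ : ∀ x, vZ x ≤ gZ x)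
    (nX' : ∀ x, wX x ≤ hX x) (nY' : ∀ x, wY x ≤ hY x) (nZ' : ∀ x, wZ x ≤ hZ x)
    (lvY : ∀ x, vY x ≤ vX x) (lgY : ∀ x, gY x ≤ gX x) (lvZ : ∀ x, vZ x ≤ vX x) (lgZ : ∀ x, gZ x ≤ gX x)
    (lwY : ∀ x, wY x ≤ wX x) (lhY : ∀ x, hY x ≤ hX x) (lwZ : ∀ x, wZ x ≤ wX x) (lhZ : ∀ x, hZ x ≤ hX x) :
    0 ≤ psKpol b 1 vX gX wX hX vY gY wY hY wZ hZ + psKpol b 1 vX gX wX hX vZ gZ wZ hZ wY hY := by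
  rw [psKpol_one_pair]
  refine add_nonneg (mul_nonneg zero_le_two (harris3_nonneg b hvX hvXm hwX hwXm fun _ => zero_le_one)) ?_
  unfold N3
  simp only [← sum_add_distrib]
  refine sum_nonneg fun x _ => sum_nonneg fun y _ => sum_nonneg fun z _ => ?_
  split_ifs
  · simp only [Pi.sub_apply, Pi.add_apply, Pi.one_apply, mul_one]
    have key := pairPointwise (α := vX x - vY x) (β := vX x - vZ x) (pT := gX x - vX x) (pL := gY x - vY x) (pM := gZ x - vZ x)
      (α' := wX y - wY y) (β' := wX y - wZ y) (qT := hX y - wX y) (qL := hY y - wY y) (qM := hZ y - wZ y)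
      (sub_nonneg.2 (lvY x)) (sub_nonneg.2 (lvZ x)) (sub_nonneg.2 (nX x)) (sub_nonneg.2 (nY x)) (sub_nonneg.2 (nZ x))
      (by linarith [lgY x]) (by linarith [lgZ x]) (sub_nonneg.2 (lwY y)) (sub_nonneg.2 (lwZ y)) (sub_nonneg.2 (nX' y))
      (sub_nonneg.2 (nY' y)) (sub_nonneg.2 (nZ' y)) (by linarith [lhY y]) (by linarith [lhZ y])
    linarith
  · simp

/-! ### §5 Initial principal cylinders and the induction -/

/-- The INITIAL PRINCIPAL CYLINDER `x₀x₁⋯x_{k−1}` on `{0,1}^d` (`= 1` when `k = 0`; the product stops at the dimension): `initPrin d 0 = 1`,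
`initPrin (d+1) (k+1) = x₀ ∧ initPrin d k` (`glue 0 ·`). [this work] -/
def initPrin : (d : ℕ) → ℕ → (Pt d → ℝ)
  | _, 0 => 1
  | 0, _ + 1 => 1
  | d + 1, k + 1 => glue (0 : Pt d → ℝ) (initPrin d k)

/-- `initPrin d 0 = 1`. [this work] -/
theorem initPrin_zero (d : ℕ) : initPrin d 0 = 1 := by cases d <;> rfl

/-- `initPrin (d+1) (k+1) = x₀ ∧ initPrin d k`. [this work] -/
theorem initPrin_succ (d k : ℕ) : initPrin (d + 1) (k + 1) = glue (0 : Pt d → ℝ) (initPrin d k) := rfl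

/-- The dictator `x₀` is `initPrin (d+1) 1`. [this work] -/
theorem initPrin_one (d : ℕ) : initPrin (d + 1) 1 = (dict0 : Pt (d + 1) → ℝ) := by
  rw [initPrin_succ, initPrin_zero]

/-- Initial principal cylinders are nonnegative and monotone. [this work] -/
theorem initPrin_nonneg_monotone : ∀ (d k : ℕ), (∀ x, 0 ≤ initPrin d k x) ∧ Monotone (initPrin d k)
  | d, 0 => by rw [initPrin_zero]; exact ⟨fun _ => zero_le_one, monotone_const⟩
  | 0, k + 1 => ⟨fun _ => zero_le_one, monotone_const⟩
  | d + 1, k + 1 => by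
    rw [initPrin_succ]
    obtain ⟨h0, hm⟩ := initPrin_nonneg_monotone d k
    exact ⟨glue_nonneg (fun _ => le_rfl) h0, glue_monotone monotone_const hm h0⟩

/-- ★★ **`S(a; t_X; t_Y, t_Z) ≥ 0`** for every initial principal cylinder `a = initPrin d k`, every profile, and all nonnegative monotone data with
`t_Y, t_Z ≤ t_X` pointwise and each quadruple nested (`v ≤ g`, `w ≤ h`): induction on the dimension, slicing along coordinate `0` (a support
coordinate of `a` unless `k = 0`, where the pair identity applies directly). [this work] -/
theorem psKpol_sym_nonneg : ∀ (d k : ℕ) (b : Fin d → ℕ) (vX gX wX hX vY gY wY hY vZ gZ wZ hZ : Pt d → ℝ),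
    (∀ x, 0 ≤ vX x) → (∀ x, 0 ≤ vY x) → (∀ x, 0 ≤ vZ x) → (∀ x, 0 ≤ wX x) → (∀ x, 0 ≤ wY x) → (∀ x, 0 ≤ wZ x) →
    Monotone vX → Monotone gX → Monotone wX → Monotone hX → Monotone vY → Monotone gY → Monotone wY → Monotone hY →
    Monotone vZ → Monotone gZ → Monotone wZ → Monotone hZ →
    (∀ x, vX x ≤ gX x) → (∀ x, vY x ≤ gY x) → (∀ x, vZ x ≤ gZ x) → (∀ x, wX x ≤ hX x) → (∀ x, wY x ≤ hY x) → (∀ x, wZ x ≤ hZ x) →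
    (∀ x, vY x ≤ vX x) → (∀ x, gY x ≤ gX x) → (∀ x, vZ x ≤ vX x) → (∀ x, gZ x ≤ gX x) →
    (∀ x, wY x ≤ wX x) → (∀ x, hY x ≤ hX x) → (∀ x, wZ x ≤ wX x) → (∀ x, hZ x ≤ hX x) →
    0 ≤ psKpol b (initPrin d k) vX gX wX hX vY gY wY hY wZ hZ + psKpol b (initPrin d k) vX gX wX hX vZ gZ wZ hZ wY hY := by
  intro d
  induction d with
  | zero =>
    intro k b vX gX wX hX vY gY wY hY vZ gZ wZ hZ hvX _ _ hwX _ _ mvX _ mwX _ _ _ _ _ _ _ _ _ nX nY nZ nX' nY' nZ' lvY lgY lvZ lgZ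
      lwY lhY lwZ lhZ
    have h1 : initPrin 0 k = 1 := by cases k <;> rfl
    rw [h1]
    exact psKpol_one_pair_nonneg b hvX mvX hwX mwX nX nY nZ nX' nY' nZ' lvY lgY lvZ lgZ lwY lhY lwZ lhZ
  | succ d ih =>
    intro k B vX gX wX hX vY gY wY hY vZ gZ wZ hZ hvX hvY hvZ hwX hwY hwZ mvX mgX mwX mhX mvY mgY mwY mhY mvZ mgZ mwZ mhZ
      nX nY nZ nX' nY' nZ' lvY lgY lvZ lgZ lwY lhY lwZ lhZ
    cases k with
    | zero =>
      rw [initPrin_zero]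
      exact psKpol_one_pair_nonneg B hvX mvX hwX mwX nX nY nZ nX' nY' nZ' lvY lgY lvZ lgZ lwY lhY lwZ lhZ
    | succ k =>
      rw [initPrin_succ]
      have hB : B = Fin.cons (B 0) (Fin.tail B) := (Fin.cons_self_tail B).symm
      set b := Fin.tail B
      have up : ∀ {u : Pt (d + 1) → ℝ}, Monotone u → ∀ (ε : Bool) (x : Pt d), sec u ε x ≤ sec u true x := by
        intro u hu ε x; cases ε
        · exact sec_false_le_sec_true hu x
        · exact le_rfl
      -- the induction hypothesis at section data: `a`-copy at the TOP sections, the other two copies at levels ε, η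
      have IH : ∀ ε η : Bool, 0 ≤
          psKpol b (initPrin d k) (sec vX true) (sec gX true) (sec wX true) (sec hX true) (sec vY ε) (sec gY ε) (sec wY ε) (sec hY ε)
            (sec wZ η) (sec hZ η)
          + psKpol b (initPrin d k) (sec vX true) (sec gX true) (sec wX true) (sec hX true) (sec vZ η) (sec gZ η) (sec wZ η) (sec hZ η)
            (sec wY ε) (sec hY ε) := fun ε η =>
        ih k b _ _ _ _ _ _ _ _ _ _ _ _ (sec_nonneg hvX true) (sec_nonneg hvY ε) (sec_nonneg hvZ η)
          (sec_nonneg hwX true) (sec_nonneg hwY ε) (sec_nonneg hwZ η)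
          (sec_monotone mvX true) (sec_monotone mgX true) (sec_monotone mwX true) (sec_monotone mhX true)
          (sec_monotone mvY ε) (sec_monotone mgY ε) (sec_monotone mwY ε) (sec_monotone mhY ε)
          (sec_monotone mvZ η) (sec_monotone mgZ η) (sec_monotone mwZ η) (sec_monotone mhZ η)
          (fun x => nX _) (fun x => nY _) (fun x => nZ _) (fun x => nX' _) (fun x => nY' _) (fun x => nZ' _)
          (fun x => (lvY _).trans (up mvX ε x)) (fun x => (lgY _).trans (up mgX ε x))
          (fun x => (lvZ _).trans (up mvX η x)) (fun x => (lgZ _).trans (up mgX η x))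
          (fun x => (lwY _).trans (up mwX ε x)) (fun x => (lhY _).trans (up mhX ε x))
          (fun x => (lwZ _).trans (up mwX η x)) (fun x => (lhZ _).trans (up mhX η x))
      rw [hB]
      match hk : B 0 with
      | 0 => rw [psKpol_cons_zero, psKpol_cons_zero]; norm_num
      | 1 => rw [psKpol_cons_one, psKpol_cons_one]; exact IH false false
      | 2 =>
        rw [psKpol_cons_two, psKpol_cons_two]
        have h10 := IH true false
        have h01 := IH false true
        linarith
      | 3 => rw [psKpol_cons_three, psKpol_cons_three]; exact IH true true
      | j + 4 => rw [psKpol_cons_add_four, psKpol_cons_add_four]; norm_num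

/-! ### §6 Consequences: `K_b ≥ 0`, the pair step and (SC) with an initial-principal slot -/

/-- ★ **`K_b(a; v,g; w,h) ≥ 0`** for an initial principal cylinder `a = initPrin d k` and nonnegative monotone `v ≤ g`, `w ≤ h`. [this work] -/
theorem psK_initPrincipal_nonneg (k : ℕ) (b : Fin d → ℕ) {v g w h : Pt d → ℝ}
    (hv : ∀ x, 0 ≤ v x) (hw : ∀ x, 0 ≤ w x) (hvm : Monotone v) (hgm : Monotone g) (hwm : Monotone w) (hhm : Monotone h)
    (hvg : ∀ x, v x ≤ g x) (hwh : ∀ x, w x ≤ h x) : 0 ≤ psK b (initPrin d k) v g w h := by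
  have h2 := psKpol_sym_nonneg d k b v g w h v g w h v g w h hv hv hv hw hw hw hvm hgm hwm hhm hvm hgm hwm hhm hvm hgm hwm hhm
    hvg hvg hvg hwh hwh hwh (fun _ => le_rfl) (fun _ => le_rfl) (fun _ => le_rfl) (fun _ => le_rfl) (fun _ => le_rfl)
    (fun _ => le_rfl) (fun _ => le_rfl) (fun _ => le_rfl)
  rw [psKpol_diag] at h2
  linarith

/-- ★ **THE PAIR STEP WITH AN INITIAL-PRINCIPAL FREE SLOT**: `0 ≤ E_b(a, v, w | a, g, h)` — the instance `f = a` of `PairStepLaw`. [this work] -/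
theorem pairStep_initPrincipal (k : ℕ) (b : Fin d → ℕ) {v g w h : Pt d → ℝ}
    (hv : ∀ x, 0 ≤ v x) (hw : ∀ x, 0 ≤ w x) (hvm : Monotone v) (hgm : Monotone g) (hwm : Monotone w) (hhm : Monotone h)
    (hvg : ∀ x, v x ≤ g x) (hwh : ∀ x, w x ≤ h x) : 0 ≤ scx b (initPrin d k) v w (initPrin d k) g h := by
  rw [scx_full_left_eq_harris_add_psK]
  refine add_nonneg ?_ (psK_initPrincipal_nonneg k b hv hw hvm hgm hwm hhm hvg hwh)
  obtain ⟨a0, am⟩ := initPrin_nonneg_monotone d k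
  have H := N3_le_N3_mul d b (initPrin d k) (v * w) 1 a0 am (fun x => mul_nonneg (hv x) (hw x)) (hvm.mul hwm hv hw)
    fun _ => zero_le_one
  rw [← mul_assoc] at H
  exact sub_nonneg.2 H

/-- ★★ **(SC) WITH AN INITIAL-PRINCIPAL SLOT**: for the initial principal cylinder `a = initPrin (d+1) k` on `{0,1}^{d+1}` (`1, x₀, x₀x₁, …`), the triple
`(F,G,H)` on `{0,1}^{d+2}` with `F = a ∘ tail` (i.e. `F = x₁x₂⋯x_k`, not depending on the sliced coordinate) and ARBITRARY nonnegative monotone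
`G, H` satisfies the slice law `2·c_B(F¹,G¹,H¹) ≤ c_{(2,B)}(F,G,H)`. [this work] -/
theorem sliceLaw_initPrincipal_free (k : ℕ) (B : Fin (d + 1) → ℕ) {G H : Pt (d + 2) → ℝ}
    (hG : ∀ x, 0 ≤ G x) (hH : ∀ x, 0 ≤ H x) (hGm : Monotone G) (hHm : Monotone H) :
    2 * tc B (sec (fun x : Pt (d + 2) => initPrin (d + 1) k (Fin.tail x)) true) (sec G true) (sec H true) ≤
      tc (Fin.cons 2 B : Fin (d + 2) → ℕ) (fun x => initPrin (d + 1) k (Fin.tail x)) G H := by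
  have hs : ∀ ε : Bool, sec (fun x : Pt (d + 2) => initPrin (d + 1) k (Fin.tail x)) ε = initPrin (d + 1) k := by
    intro ε; funext x; simp [sec, Fin.tail_cons]
  have e := tc_cons_two_sub_two_eq_scx B (fun x : Pt (d + 2) => initPrin (d + 1) k (Fin.tail x)) G H
  rw [hs, hs] at e
  have key := pairStep_initPrincipal k B (v := sec G false) (g := sec G true) (w := sec H false) (h := sec H true)
    (sec_nonneg hG false) (sec_nonneg hH false) (sec_monotone hGm false) (sec_monotone hGm true) (sec_monotone hHm false)
    (sec_monotone hHm true) (sec_false_le_sec_true hGm) (sec_false_le_sec_true hHm)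
  rw [hs]
  linarith

end

end Summit.CriticalPhenomena.PercolationContinuityZ3.Theorems.SahiThreeCopy
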